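import Literature.NumberTheory.LFunctions.Zhang2022.RepairStructuralBarrier
import Literature.NumberTheory.LFunctions.Zhang2022.RepairGluedForm

/-!
# Repair rung F-S1R, barrier side: the structural verdict statement in BLOCK form (K-S4, part 2)

Y. Zhang, *Discrete mean estimates and the Landau–Siegel zero*, arXiv:2211.02515v1 (2022)
[Zhang2022LandauSiegel] — an unrefereed manuscript under adjudication; nothing in this file is a
claim about its Theorems 1–2 or about Landau–Siegel zeros.

Companion of `RepairStructuralBarrier` (cell ruling R3, plan `repair/p4/Q2-ARCHITECTURE.md`). There
the verdict shapes take the dictionary identities on the GLUED profile (`C₂₃₂ = 𝔅(𝔤)`,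
`𝔡′+𝔡 = P(𝔤,f)`); the identity theorems of the cell's Track K arrive PER BLOCK — `𝔠₁ = 𝔅(g₁)`,
`𝔠₂ = 𝔅(g₂)`, `C₂₃₃ = 𝔅(f)` (K-S1, pair-block Gram dictionary), `𝔠₃ = P(g₁, R̃g₂)` (K-S2, the exact
reflected cross term), `𝔡 = P(g₁, f)`, `𝔡′ = P(R̃g₂, f)` (K-S3) — with `R̃` the functional-equation
reflection (`RepairFormReflection`) and the gluing calculus of `RepairGluedForm`
(`𝔅(g₁ + R̃g₂) = 𝔅(g₁) + 𝔅(g₂) + 2 Re P(g₁, R̃g₂)`, `P(g₁ + R̃g₂, f) = P(g₁,f) + P(R̃g₂,f)`). This file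
states the three verdict shapes with exactly those block hypotheses:
`not_repairable_true_need_of_blocks` (joint currency), `not_printed_chain_of_blocks` (the printed
triple), `margin_nonneg_of_blocks` (no negative direction). Elementary; no new `Prop` facts.
-/

noncomputable section

open MeasureTheory Set
open scoped Real ComplexConjugate

namespace Literature.NumberTheory.LFunctions.Zhang2022

namespace Repair

/-! ### Design level, BLOCK form -/

/-- **K-S4, block form — NOT-REPAIRABLE-IN-CLASS in the joint currency.** Functionals of record:
`c1S`, `c2S` (the `𝔠₁`, `𝔠₂` blocks of (8.23), (9.7)), `c3S` (the `𝔠₃` slot of (18.1), exact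
bilinear reading), `C233S` ((2.33)), `dS`, `dpS` (`𝔡`, `𝔡′` of (10.17)); profiles of record: `g1`
(`H₁`-side), `g2` (`H₂`-side, UNREFLECTED), `fp` (probe). IF on the class the profiles are `H¹` and
the block identities hold (K-S1: `hc1`, `hc2`, `h233`; K-S2: `hc3`; K-S3: `hd`, `hdp`), THEN for every
admissible design `(𝔠₁ + 𝔠₂ + 2 Re 𝔠₃)·C₂₃₃ < |𝔡 + 𝔡′|²` is false.
[cite: Zhang2022LandauSiegel, §2 (2.18), Props. 2.4–2.6, (2.32)–(2.33); §18 (18.1)] -/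
theorem not_repairable_true_need_of_blocks
    (c1S c2S C233S : Theta → ℝ) (c3S dS dpS : Theta → ℂ)
    (g1 g1' g2 g2' fp fp' : Theta → ℝ → ℂ)
    (hg1 : ∀ θ, AdmissibleTheta θ → IsH1OnUnitInterval (g1 θ) (g1' θ))
    (hg2 : ∀ θ, AdmissibleTheta θ → IsH1OnUnitInterval (g2 θ) (g2' θ))
    (hfp : ∀ θ, AdmissibleTheta θ → IsH1OnUnitInterval (fp θ) (fp' θ))
    (hc1 : ∀ θ, AdmissibleTheta θ → c1S θ = mainTermForm (g1 θ) (g1' θ))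
    (hc2 : ∀ θ, AdmissibleTheta θ → c2S θ = mainTermForm (g2 θ) (g2' θ))
    (hc3 : ∀ θ, AdmissibleTheta θ →
      c3S θ = mainTermFormPolar (g1 θ) (g1' θ) (reflProfile (g2 θ)) (reflDeriv (g2' θ)))
    (h233 : ∀ θ, AdmissibleTheta θ → C233S θ = mainTermForm (fp θ) (fp' θ))
    (hd : ∀ θ, AdmissibleTheta θ → dS θ = mainTermFormPolar (g1 θ) (g1' θ) (fp θ) (fp' θ))
    (hdp : ∀ θ, AdmissibleTheta θ →
      dpS θ = mainTermFormPolar (reflProfile (g2 θ)) (reflDeriv (g2' θ)) (fp θ) (fp' θ)) :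
    ∀ θ, AdmissibleTheta θ →
      ¬ ((c1S θ + c2S θ + 2 * (c3S θ).re) * C233S θ < ‖dS θ + dpS θ‖ ^ 2) := by
  intro θ hθ
  rw [hc1 θ hθ, hc2 θ hθ, hc3 θ hθ, h233 θ hθ, hd θ hθ, hdp θ hθ]
  exact not_blocks_lt_norm_sq_dsum (hg1 θ hθ) (hg2 θ hθ) (hfp θ hθ)

/-- **K-S4, block form — the printed chain is infeasible in class**: no admissible design has
`𝔠₁ + 𝔠₂ + 2 Re 𝔠₃ < 0.001`, `C₂₃₃ < 3000` and `|𝔡 + 𝔡′|² > 25` together.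
[cite: Zhang2022LandauSiegel, §2 Props. 2.4–2.5, (2.32)–(2.33)] -/
theorem not_printed_chain_of_blocks
    (c1S c2S C233S : Theta → ℝ) (c3S dS dpS : Theta → ℂ)
    (g1 g1' g2 g2' fp fp' : Theta → ℝ → ℂ)
    (hg1 : ∀ θ, AdmissibleTheta θ → IsH1OnUnitInterval (g1 θ) (g1' θ))
    (hg2 : ∀ θ, AdmissibleTheta θ → IsH1OnUnitInterval (g2 θ) (g2' θ))
    (hfp : ∀ θ, AdmissibleTheta θ → IsH1OnUnitInterval (fp θ) (fp' θ))
    (hc1 : ∀ θ, AdmissibleTheta θ → c1S θ = mainTermForm (g1 θ) (g1' θ))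
    (hc2 : ∀ θ, AdmissibleTheta θ → c2S θ = mainTermForm (g2 θ) (g2' θ))
    (hc3 : ∀ θ, AdmissibleTheta θ →
      c3S θ = mainTermFormPolar (g1 θ) (g1' θ) (reflProfile (g2 θ)) (reflDeriv (g2' θ)))
    (h233 : ∀ θ, AdmissibleTheta θ → C233S θ = mainTermForm (fp θ) (fp' θ))
    (hd : ∀ θ, AdmissibleTheta θ → dS θ = mainTermFormPolar (g1 θ) (g1' θ) (fp θ) (fp' θ))
    (hdp : ∀ θ, AdmissibleTheta θ →
      dpS θ = mainTermFormPolar (reflProfile (g2 θ)) (reflDeriv (g2' θ)) (fp θ) (fp' θ)) :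
    ∀ θ, AdmissibleTheta θ →
      ¬ (c1S θ + c2S θ + 2 * (c3S θ).re < 1 / 1000 ∧ C233S θ < 3000 ∧ 25 < ‖dS θ + dpS θ‖ ^ 2) := by
  intro θ hθ
  rw [hc1 θ hθ, hc2 θ hθ, hc3 θ hθ, h233 θ hθ, hd θ hθ, hdp θ hθ,
    ← mainTermForm_add_refl (hg1 θ hθ) (hg2 θ hθ), ← polar_add_refl_left (hg1 θ hθ) (hg2 θ hθ)
      (hfp θ hθ)]
  exact not_printedTriple_of_isH1 ((hg1 θ hθ).add_refl (hg2 θ hθ)) (hfp θ hθ)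

/-- **T-zero impossible in class (block form)**: `0 ≤ 𝔠₁ + 𝔠₂ + 2 Re 𝔠₃` at every admissible
design, as soon as the three blocks are the form values of the design's halves.
[cite: Zhang2022LandauSiegel, §2 Lemma 2.3, (2.32); §18 (18.1)] -/
theorem margin_nonneg_of_blocks (c1S c2S : Theta → ℝ) (c3S : Theta → ℂ)
    (g1 g1' g2 g2' : Theta → ℝ → ℂ)
    (hg1 : ∀ θ, AdmissibleTheta θ → IsH1OnUnitInterval (g1 θ) (g1' θ))
    (hg2 : ∀ θ, AdmissibleTheta θ → IsH1OnUnitInterval (g2 θ) (g2' θ))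
    (hc1 : ∀ θ, AdmissibleTheta θ → c1S θ = mainTermForm (g1 θ) (g1' θ))
    (hc2 : ∀ θ, AdmissibleTheta θ → c2S θ = mainTermForm (g2 θ) (g2' θ))
    (hc3 : ∀ θ, AdmissibleTheta θ →
      c3S θ = mainTermFormPolar (g1 θ) (g1' θ) (reflProfile (g2 θ)) (reflDeriv (g2' θ))) :
    ∀ θ, AdmissibleTheta θ → 0 ≤ c1S θ + c2S θ + 2 * (c3S θ).re := by
  intro θ hθ
  rw [hc1 θ hθ, hc2 θ hθ, hc3 θ hθ]
  exact blocks_add_cross_nonneg (hg1 θ hθ) (hg2 θ hθ)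

end Repair

end Literature.NumberTheory.LFunctions.Zhang2022
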